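import Mathlib
import Summits.Ventures.HodgeRepro2.Hypothesis
import Summits.Ventures.HodgeRepro2.BallActionU21
import Summits.Ventures.HodgeRepro2.T5IwasawaSplit

/-!
# The unitary group of a definite hermitian form is bounded

Shimura's Theorem 8.1 (J. Math. Soc. Japan 31 (1979), §4 (4.14), §8) and Dimitrov–Ramakrishnan
(Doc. Math. 20 (2015), §1–§2) work with a hermitian form `H` over the CM field `K` which is
DEFINITE at every place other than the one indefinite place `τ₁`.  The first half of «`Γ_1` is a
discrete subgroup of `U(2,1)`» is the boundedness of the unitary groups at the definite places; this
file kernel-checks it on the shapes of `Hypothesis.lean` (gen-0 file, p385637):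

* `entrySum` — the sum of the absolute values of the entries of a complex matrix, the bookkeeping
  quantity for all bounds (`norm_apply_le_entrySum`, `norm_mul_apply_le`, `entrySum_mul_le`,
  `norm_mul_mul_apply_le`);
* `norm_apply_le_one_of_conjTranspose_mul_self_eq_one` — the entries of a unitary matrix are bounded
  by `1`;
* `exists_entry_bound_of_posDef` — if `P` is positive definite, the entries of every `A` with
  `Aᴴ P A = P` are bounded by a constant depending on `P` only (from p1's
  `T5IwasawaSplit.exists_conjTranspose_mul_mul_eq_one`, p392887: `gᴴ P g = 1`, so `g⁻¹ A g` is
  unitary); `exists_entry_bound_of_posDef_or_neg` — the same for `-P` positive definite;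
* `posDef_neg_of_forall_eigenvalues_neg` / `signatureAt_of_isHermitian` /
  `IsDefiniteAt.posDef_or_neg_posDef` — the `IsDefiniteAt` shape of `Hypothesis.lean` (signature
  `(m,0)` or `(0,m)` through the eigenvalue count of `signatureAt`) gives `H.map τ` or `-(H.map τ)`
  positive definite;
* `exists_entry_bound_of_isDefiniteAt` — **the statement used downstream**: at a place `τ` where
  `H` is definite, the entries of `τ(γ)`, `γ ∈ U(H)`, are bounded by a constant depending on `(H, τ)`
  only.

The second half (finiteness of bounded subsets of `U(H)(𝓞_K)`, closedness and discreteness of the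
image in `M_m(ℂ)` and in `U(2,1)`) is `IntegralUnitaryDiscrete.lean`.
-/

open Matrix NumberField
open scoped ComplexOrder

namespace Summit.Ventures.HodgeRepro2.ShimuraData

/-! ### Entry sums -/

/-- The sum of the absolute values of all entries of a complex `m × m` matrix. -/
noncomputable def entrySum {m : ℕ} (X : Matrix (Fin m) (Fin m) ℂ) : ℝ :=
  ∑ i, ∑ j, ‖X i j‖

/-- `entrySum` is non-negative. -/
theorem entrySum_nonneg {m : ℕ} (X : Matrix (Fin m) (Fin m) ℂ) : 0 ≤ entrySum X :=
  Finset.sum_nonneg fun _ _ => Finset.sum_nonneg fun _ _ => norm_nonneg _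

/-- A row sum is bounded by the entry sum. -/
theorem sum_row_le_entrySum {m : ℕ} (X : Matrix (Fin m) (Fin m) ℂ) (i : Fin m) :
    ∑ k, ‖X i k‖ ≤ entrySum X :=
  Finset.single_le_sum (f := fun i' => ∑ k, ‖X i' k‖)
    (fun _ _ => Finset.sum_nonneg fun _ _ => norm_nonneg _) (Finset.mem_univ i)

/-- A column sum is bounded by the entry sum. -/
theorem sum_col_le_entrySum {m : ℕ} (X : Matrix (Fin m) (Fin m) ℂ) (j : Fin m) :
    ∑ k, ‖X k j‖ ≤ entrySum X := by
  unfold entrySum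
  rw [Finset.sum_comm]
  exact Finset.single_le_sum (f := fun j' => ∑ k, ‖X k j'‖)
    (fun _ _ => Finset.sum_nonneg fun _ _ => norm_nonneg _) (Finset.mem_univ j)

/-- Every entry is bounded by the entry sum. -/
theorem norm_apply_le_entrySum {m : ℕ} (X : Matrix (Fin m) (Fin m) ℂ) (i j : Fin m) :
    ‖X i j‖ ≤ entrySum X :=
  (Finset.single_le_sum (fun _ _ => norm_nonneg _) (Finset.mem_univ j)).trans
    (sum_row_le_entrySum X i)

/-- An entry of a product is bounded by the product of the entry sums. -/
theorem norm_mul_apply_le {m : ℕ} (X Y : Matrix (Fin m) (Fin m) ℂ) (i j : Fin m) :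
    ‖(X * Y) i j‖ ≤ entrySum X * entrySum Y := by
  rw [Matrix.mul_apply]
  calc ‖∑ k, X i k * Y k j‖ ≤ ∑ k, ‖X i k * Y k j‖ := norm_sum_le _ _
    _ = ∑ k, ‖X i k‖ * ‖Y k j‖ := by simp only [norm_mul]
    _ ≤ ∑ k, ‖X i k‖ * ∑ l, ‖Y l j‖ := by
        refine Finset.sum_le_sum fun k _ => ?_
        exact mul_le_mul_of_nonneg_left
          (Finset.single_le_sum (f := fun l => ‖Y l j‖) (fun _ _ => norm_nonneg _)
            (Finset.mem_univ k)) (norm_nonneg _)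
    _ = (∑ k, ‖X i k‖) * ∑ l, ‖Y l j‖ := by rw [Finset.sum_mul]
    _ ≤ entrySum X * entrySum Y :=
        mul_le_mul (sum_row_le_entrySum X i) (sum_col_le_entrySum Y j)
          (Finset.sum_nonneg fun _ _ => norm_nonneg _) (entrySum_nonneg X)

/-- The entry sum of a matrix with entries bounded by `r` is at most `m² r`. -/
theorem entrySum_le_of_forall_norm_le {m : ℕ} {X : Matrix (Fin m) (Fin m) ℂ} {r : ℝ}
    (h : ∀ i j, ‖X i j‖ ≤ r) : entrySum X ≤ (m * m : ℝ) * r := by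
  unfold entrySum
  calc ∑ i, ∑ j, ‖X i j‖ ≤ ∑ i : Fin m, ∑ j : Fin m, r :=
        Finset.sum_le_sum fun i _ => Finset.sum_le_sum fun j _ => h i j
    _ = (m * m : ℝ) * r := by
        simp only [Finset.sum_const, Finset.card_univ, Fintype.card_fin, nsmul_eq_mul]
        ring

/-- The entry sum of a product is at most `m²` times the product of the entry sums. -/
theorem entrySum_mul_le {m : ℕ} (X Y : Matrix (Fin m) (Fin m) ℂ) :
    entrySum (X * Y) ≤ (m * m : ℝ) * (entrySum X * entrySum Y) :=
  entrySum_le_of_forall_norm_le fun i j => norm_mul_apply_le X Y i j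

/-- An entry of a triple product `X * Y * Z` with `‖Y i j‖ ≤ r` is bounded by
`m² · entrySum X · (m² r) · entrySum Z`. -/
theorem norm_mul_mul_apply_le {m : ℕ} (X Y Z : Matrix (Fin m) (Fin m) ℂ) {r : ℝ}
    (hY : ∀ i j, ‖Y i j‖ ≤ r) (i j : Fin m) :
    ‖(X * Y * Z) i j‖ ≤ (m * m : ℝ) * (entrySum X * ((m * m : ℝ) * r)) * entrySum Z := by
  calc ‖(X * Y * Z) i j‖ ≤ entrySum (X * Y) * entrySum Z := norm_mul_apply_le _ _ i j
    _ ≤ (m * m : ℝ) * (entrySum X * entrySum Y) * entrySum Z :=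
        mul_le_mul_of_nonneg_right (entrySum_mul_le X Y) (entrySum_nonneg Z)
    _ ≤ (m * m : ℝ) * (entrySum X * ((m * m : ℝ) * r)) * entrySum Z := by
        refine mul_le_mul_of_nonneg_right ?_ (entrySum_nonneg Z)
        refine mul_le_mul_of_nonneg_left ?_ (by positivity)
        exact mul_le_mul_of_nonneg_left (entrySum_le_of_forall_norm_le hY) (entrySum_nonneg X)

/-! ### The unitary group of a definite form is bounded -/

/-- The entries of a matrix `V` with `Vᴴ V = 1` have absolute value at most `1`. -/
theorem norm_apply_le_one_of_conjTranspose_mul_self_eq_one {m : ℕ}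
    {V : Matrix (Fin m) (Fin m) ℂ} (hV : Vᴴ * V = 1) (i j : Fin m) : ‖V i j‖ ≤ 1 := by
  have h1 : (Vᴴ * V) j j = 1 := by rw [hV, Matrix.one_apply_eq]
  rw [Matrix.mul_apply] at h1
  simp only [Matrix.conjTranspose_apply] at h1
  have h2 : ∀ k, star (V k j) * V k j = ((‖V k j‖ ^ 2 : ℝ) : ℂ) := fun k => by
    rw [mul_comm, Complex.star_def, Complex.mul_conj, Complex.normSq_eq_norm_sq]
  simp_rw [h2] at h1
  rw [← Complex.ofReal_sum] at h1
  have h3 : ∑ k, ‖V k j‖ ^ 2 = 1 := by exact_mod_cast h1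
  have h4 : ‖V i j‖ ^ 2 ≤ 1 :=
    h3 ▸ Finset.single_le_sum (fun k _ => sq_nonneg ‖V k j‖) (Finset.mem_univ i)
  nlinarith [norm_nonneg (V i j)]

/-- If `gᴴ P g = 1` with `g` invertible, then `P = (g⁻¹)ᴴ g⁻¹`. -/
theorem eq_conjTranspose_inv_mul_inv_of_conjTranspose_mul_mul_eq_one {m : ℕ}
    {P g : Matrix (Fin m) (Fin m) ℂ} (hg : IsUnit g) (hgP : gᴴ * P * g = 1) :
    (g⁻¹)ᴴ * g⁻¹ = P := by
  have hdet : IsUnit g.det := (Matrix.isUnit_iff_isUnit_det g).mp hg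
  have hdet' : IsUnit gᴴ.det := by
    rw [Matrix.det_conjTranspose]; exact hdet.star
  calc (g⁻¹)ᴴ * g⁻¹ = (g⁻¹)ᴴ * (gᴴ * P * g) * g⁻¹ := by rw [hgP, mul_one]
    _ = ((g⁻¹)ᴴ * gᴴ) * P * (g * g⁻¹) := by simp only [Matrix.mul_assoc]
    _ = P := by
        rw [Matrix.conjTranspose_nonsing_inv, Matrix.nonsing_inv_mul _ hdet',
          Matrix.mul_nonsing_inv _ hdet, one_mul, mul_one]

/-- The unitary group of a positive definite form is bounded: there is a constant `C`, depending
on `P` only, with `‖A i j‖ ≤ C` for every `A` with `Aᴴ P A = P`.  Proof: by p1's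
`exists_conjTranspose_mul_mul_eq_one` (p392887) there is an invertible `g` with `gᴴ P g = 1`; then
`V := g⁻¹ A g` satisfies `Vᴴ V = 1`, so its entries are bounded by `1`, and `A = g V g⁻¹`. -/
theorem exists_entry_bound_of_posDef {m : ℕ} {P : Matrix (Fin m) (Fin m) ℂ} (hP : P.PosDef) :
    ∃ C : ℝ, ∀ A : Matrix (Fin m) (Fin m) ℂ, Aᴴ * P * A = P → ∀ i j, ‖A i j‖ ≤ C := by
  obtain ⟨g, hg, hgP⟩ := T5IwasawaSplit.exists_conjTranspose_mul_mul_eq_one hP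
  have hdet : IsUnit g.det := (Matrix.isUnit_iff_isUnit_det g).mp hg
  have hP' : (g⁻¹)ᴴ * g⁻¹ = P :=
    eq_conjTranspose_inv_mul_inv_of_conjTranspose_mul_mul_eq_one hg hgP
  refine ⟨(m * m : ℝ) * (entrySum g * ((m * m : ℝ) * 1)) * entrySum g⁻¹, fun A hA i j => ?_⟩
  -- `V := g⁻¹ A g` is unitary
  set V : Matrix (Fin m) (Fin m) ℂ := g⁻¹ * A * g with hVdef
  have hV : Vᴴ * V = 1 := by
    have e1 : Vᴴ * V = gᴴ * (Aᴴ * ((g⁻¹)ᴴ * g⁻¹) * A) * g := by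
      rw [hVdef]
      simp only [Matrix.conjTranspose_mul, Matrix.mul_assoc]
    rw [e1, hP', hA, hgP]
  -- `A = g V g⁻¹`
  have hAV : A = g * V * g⁻¹ := by
    rw [hVdef, Matrix.mul_assoc g⁻¹ A g, Matrix.mul_nonsing_inv_cancel_left _ _ hdet,
      Matrix.mul_nonsing_inv_cancel_right _ _ hdet]
  rw [hAV]
  exact norm_mul_mul_apply_le g V g⁻¹
    (norm_apply_le_one_of_conjTranspose_mul_self_eq_one hV) i j

/-- The unitary group of a negative definite form is bounded as well
(`Aᴴ P A = P ↔ Aᴴ (-P) A = -P`). -/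
theorem exists_entry_bound_of_posDef_or_neg {m : ℕ} {P : Matrix (Fin m) (Fin m) ℂ}
    (hP : P.PosDef ∨ (-P).PosDef) :
    ∃ C : ℝ, ∀ A : Matrix (Fin m) (Fin m) ℂ, Aᴴ * P * A = P → ∀ i j, ‖A i j‖ ≤ C := by
  rcases hP with hP | hP
  · exact exists_entry_bound_of_posDef hP
  · obtain ⟨C, hC⟩ := exists_entry_bound_of_posDef hP
    refine ⟨C, fun A hA i j => hC A ?_ i j⟩
    rw [Matrix.mul_neg, Matrix.neg_mul, hA]

/-! ### From the `IsDefiniteAt` shape to positive definiteness -/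

/-- A Hermitian matrix all of whose eigenvalues are negative has `-P` positive definite
(spectral theorem: `-P = U (-D) U*`). -/
theorem posDef_neg_of_forall_eigenvalues_neg {m : ℕ} {P : Matrix (Fin m) (Fin m) ℂ}
    (hP : P.IsHermitian) (h : ∀ i, hP.eigenvalues i < 0) : (-P).PosDef := by
  have hspec := hP.spectral_theorem
  rw [Unitary.conjStarAlgAut_apply] at hspec
  rw [hspec, ← Matrix.neg_mul, ← Matrix.mul_neg, Matrix.diagonal_neg,
    Unitary.isUnit_coe.posDef_star_right_conjugate_iff, Matrix.posDef_diagonal_iff]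
  intro i
  have : (0 : ℝ) < -hP.eigenvalues i := neg_pos.mpr (h i)
  simpa [Function.comp, Complex.ofReal_neg] using Complex.zero_lt_real.mpr this

/-- Unfolding `signatureAt` on a Hermitian matrix. -/
theorem signatureAt_of_isHermitian {K : Type*} [Field K] {m : ℕ} (τ : K →+* ℂ)
    (H : Matrix (Fin m) (Fin m) K) (h : (H.map τ).IsHermitian) :
    signatureAt K τ H =
      ((Finset.univ.filter fun i => 0 < h.eigenvalues i).card,
        (Finset.univ.filter fun i => h.eigenvalues i < 0).card) := by
  unfold signatureAt
  rw [dif_pos h]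

/-- The `IsDefiniteAt` shape of `Hypothesis.lean`, on a Hermitian `H.map τ`, gives `H.map τ` or
`-(H.map τ)` positive definite. -/
theorem IsDefiniteAt.posDef_or_neg_posDef {K : Type*} [Field K] {m : ℕ} {τ : K →+* ℂ}
    {H : Matrix (Fin m) (Fin m) K} (h : (H.map τ).IsHermitian) (hd : IsDefiniteAt K τ H) :
    (H.map τ).PosDef ∨ (-(H.map τ)).PosDef := by
  unfold IsDefiniteAt at hd
  rw [signatureAt_of_isHermitian τ H h] at hd
  rcases hd with hd | hd
  · left
    have hc : (Finset.univ.filter fun i => 0 < h.eigenvalues i).card = Fintype.card (Fin m) := by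
      rw [Fintype.card_fin]; exact (Prod.mk.inj hd).1
    rw [Finset.card_eq_iff_eq_univ, Finset.eq_univ_iff_forall] at hc
    exact h.posDef_iff_eigenvalues_pos.mpr fun i => (Finset.mem_filter.mp (hc i)).2
  · right
    have hc : (Finset.univ.filter fun i => h.eigenvalues i < 0).card = Fintype.card (Fin m) := by
      rw [Fintype.card_fin]; exact (Prod.mk.inj hd).2
    rw [Finset.card_eq_iff_eq_univ, Finset.eq_univ_iff_forall] at hc
    exact posDef_neg_of_forall_eigenvalues_neg h fun i => (Finset.mem_filter.mp (hc i)).2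

section CMField

variable {K : Type*} [Field K] [NumberField K] [NumberField.IsCMField K]

/-- For a Hermitian form `H` over the CM field `K`, every `H.map τ` is a Hermitian matrix. -/
theorem isHermitian_map_of_isHermitianForm' {m : ℕ} {H : Matrix (Fin m) (Fin m) K}
    (hH : IsHermitianForm K H) (τ : K →+* ℂ) : (H.map τ).IsHermitian := by
  show (H.map τ)ᴴ = H.map τ
  rw [conjTranspose_map]
  unfold IsHermitianForm at hH
  rw [hH]

/-- At a place where `H` is definite, the entries of `τ(γ)`, `γ ∈ U(H)`, are bounded by a constant
depending on `(H, τ)` only. -/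
theorem exists_entry_bound_of_isDefiniteAt {m : ℕ} {H : Matrix (Fin m) (Fin m) K}
    (hH : IsHermitianForm K H) {τ : K →+* ℂ} (hd : IsDefiniteAt K τ H) :
    ∃ C : ℝ, ∀ γ ∈ unitaryGroup K H, ∀ i j, ‖((γ : Matrix (Fin m) (Fin m) K).map τ) i j‖ ≤ C := by
  obtain ⟨C, hC⟩ := exists_entry_bound_of_posDef_or_neg
    (IsDefiniteAt.posDef_or_neg_posDef (isHermitian_map_of_isHermitianForm' hH τ) hd)
  exact ⟨C, fun γ hγ i j => hC _ (conjTranspose_map_mul_map_mul_map τ hγ) i j⟩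

end CMField

end Summit.Ventures.HodgeRepro2.ShimuraData
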